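import Summits.QuantumAdvantage.AdviceFreeQNC0.LevelSetDegreeOne
import HarnessLib

/-!
# Cell qa-qnc0 (rung F-Q1, route RingFrame, crux α, line `product`): block-additive maps — the move
# calculus behind far-set balance for `Γ u = 𝟙 ⊕ ⨁_i G_i(u|_{B_i})` (qn-p1 TARGET §20.8, ask P6e)

Infrastructure for the prover's τ''-free proof of `Sketch8b.BlockAdditiveFSB`
(HOME/qa-qnc0-prover/PROVER-MEMO-gen4.md §2), all PROVED:

* vocabulary: `gammaBA` (the block-additive map, verbatim shape of Sketch8b), `BlockLocal`, block
  MOVES on GLOBAL pattern vectors `bmove` (replace block `i` of `u` by block `i` of `y`), block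
  weights `wtOn`/`blockOf`, increments `incr`/`incrM`, the CODE NORM `cnorm D z = distFail D (z ⊕ 𝟙)`,
  moves `Mv`, types `typ`, pair configurations `start2`/`end2`, GOOD pairs `Good`;
* move calculus: `gammaBA_bmove` (`Γ(u∘m) = Γ u ⊕ Δ(m)`), `wt_bmove` (class changes by the type),
  `bmove_comm`, `bmove_bmove_same`, `end2_eq`, `wt_start2`;
* norm calculus (from `distFail_xor3_le`): `cnorm_xor_le`, `distFail_xor_le_add_cnorm`,
  `cnorm_xor_le_distFail_add`; hence `cnorm_pair_lt_of_good`: a GOOD (type-1, type-2) pair of moves on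
  distinct blocks has `‖Δ(a) ⊕ Δ(b)‖ < 2θ·2^{L'}` — ONE near context certifies it;
Sequels: `BlockAdditiveCounts.lean` (residue counts for block weights, class-compatible contexts, the
context involution) and `BlockAdditiveFSB.lean` (bad pairs are `O(X)`-rare, the characteristic-2
three-cycle, the landing count, `BlockAdditiveFSB` with τ'' = 0).  WHAT THIS IS NOT: nothing on FSB/FW at general
column degree (the crux), nothing on α; no separation claim.
-/

noncomputable section

namespace Summit.QuantumAdvantage.AdviceFreeQNC0

open Finset
open Literature.Computability.MetaComplexity Literature.Computability.MetaComplexity.Smolensky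

namespace BlockAdditive

variable {L L' k : ℕ}

/-! ### Vocabulary -/

/-- The block-additive map of `Sketch8b.BlockAdditiveFSB`: `Γ u = 𝟙 ⊕ ⨁_i G_i(u)`. -/
def gammaBA (G : Fin k → (Fin L → Bool) → (Fin L' → Bool) → Bool) :
    (Fin L → Bool) → (Fin L' → Bool) → Bool :=
  fun u v => !(Nat.bodd (univ.filter fun i : Fin k => G i u v = true).card)

/-- Block-locality of the summands: `G i u` depends only on the bits of block `i`. -/
def BlockLocal (blk : Fin L → Fin k) (G : Fin k → (Fin L → Bool) → (Fin L' → Bool) → Bool) : Prop :=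
  ∀ i u u', (∀ j, blk j = i → u j = u' j) → G i u = G i u'

/-- Replace block `i` of `u` by block `i` of the (global) pattern vector `y`. -/
def bmove (blk : Fin L → Fin k) (u : Fin L → Bool) (i : Fin k) (y : Fin L → Bool) : Fin L → Bool :=
  fun j => if blk j = i then y j else u j

/-- Weight of `u` on the coordinate set `S`. -/
def wtOn (S : Finset (Fin L)) (u : Fin L → Bool) : ℕ := (S.filter fun j => u j = true).card

/-- The coordinates of block `i`. -/
def blockOf (blk : Fin L → Fin k) (i : Fin k) : Finset (Fin L) := univ.filter fun j => blk j = i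

/-- Increment of a block-`i` move `x → y` (a function of the two block patterns only). -/
def incr (G : Fin k → (Fin L → Bool) → (Fin L' → Bool) → Bool) (i : Fin k) (x y : Fin L → Bool) :
    (Fin L' → Bool) → Bool :=
  fun v => xor (G i x v) (G i y v)

/-- The CODE NORM `‖z‖ = dist(z, C)`, `C = 𝟙 ⊕ 𝓕_D` the linear part of the fail family:
`cnorm D z = distFail D (z ⊕ 𝟙)`. -/
def cnorm (D : ℕ) (z : (Fin L' → Bool) → Bool) : ℕ := distFail D fun v => !z v

/-! ### Parity bookkeeping -/

/-- Changing the predicate at one index changes the parity of the count by the two truth values. -/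
theorem bodd_card_filter_congr_off {ι : Type*} [Fintype ι] [DecidableEq ι] (p q : ι → Bool) (i : ι)
    (h : ∀ i', i' ≠ i → p i' = q i') :
    Nat.bodd (univ.filter fun i' => p i' = true).card =
      xor (Nat.bodd (univ.filter fun i' => q i' = true).card) (xor (p i) (q i)) := by
  have hsplit : ∀ f : ι → Bool, (univ.filter fun i' => f i' = true).card =
      ((univ.erase i).filter fun i' => f i' = true).card + (if f i = true then 1 else 0) := by
    intro f
    have hu : (univ : Finset ι) = insert i (univ.erase i) := by
      rw [Finset.insert_erase (Finset.mem_univ i)]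
    conv_lhs => rw [hu]
    rw [Finset.filter_insert]
    by_cases hf : f i = true
    · rw [if_pos hf, Finset.card_insert_of_notMem (by simp), if_pos hf]
    · rw [if_neg hf, if_neg hf, add_zero]
  have heq : ((univ.erase i).filter fun i' => p i' = true) = ((univ.erase i).filter fun i' => q i' = true) := by
    refine Finset.filter_congr fun i' hi' => ?_
    rw [h i' (Finset.ne_of_mem_erase hi')]
  rw [hsplit p, hsplit q, heq, Nat.bodd_add, Nat.bodd_add]
  cases p i <;> cases q i <;> simp

/-! ### Move calculus -/

/-- `bmove u i y` agrees with `u` off block `i`. -/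
theorem bmove_off (blk : Fin L → Fin k) (u : Fin L → Bool) (i : Fin k) (y : Fin L → Bool) {j : Fin L}
    (hj : blk j ≠ i) : bmove blk u i y j = u j := by
  unfold bmove; rw [if_neg hj]

/-- `bmove u i y` agrees with `y` on block `i`. -/
theorem bmove_on (blk : Fin L → Fin k) (u : Fin L → Bool) (i : Fin k) (y : Fin L → Bool) {j : Fin L}
    (hj : blk j = i) : bmove blk u i y j = y j := by
  unfold bmove; rw [if_pos hj]

/-- **A block move changes `Γ` by the increment**: `Γ(u ∘ m) = Γ u ⊕ Δ(m)`. -/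
theorem gammaBA_bmove {blk : Fin L → Fin k} {G : Fin k → (Fin L → Bool) → (Fin L' → Bool) → Bool}
    (hG : BlockLocal blk G) (u : Fin L → Bool) (i : Fin k) (y : Fin L → Bool) :
    gammaBA G (bmove blk u i y) = fun v => xor (gammaBA G u v) (incr G i u y v) := by
  funext v
  unfold gammaBA incr
  have hi : G i (bmove blk u i y) = G i y :=
    hG i _ _ fun j hj => bmove_on blk u i y hj
  have hoff : ∀ i', i' ≠ i → G i' (bmove blk u i y) v = G i' u v := by
    intro i' hi'
    rw [hG i' (bmove blk u i y) u fun j hj => bmove_off blk u i y (by rw [hj]; exact hi')]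
  rw [bodd_card_filter_congr_off (fun i' => G i' (bmove blk u i y) v) (fun i' => G i' u v) i hoff, hi]
  cases Nat.bodd (univ.filter fun i' => G i' u v = true).card <;> cases G i u v <;> cases G i y v <;> rfl

/-- The weight splits into the block-`i` weight and the rest. -/
theorem wt_eq_wtOn_add (blk : Fin L → Fin k) (i : Fin k) (u : Fin L → Bool) :
    wt u = wtOn (blockOf blk i) u + wtOn (univ.filter fun j => blk j ≠ i) u := by
  unfold wt wtOn blockOf
  rw [Finset.filter_filter, Finset.filter_filter]
  have h := Finset.card_filter_add_card_filter_not
    (s := univ.filter fun j : Fin L => u j = true) (p := fun j => blk j = i)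
  rw [Finset.filter_filter, Finset.filter_filter] at h
  rw [← h]
  congr 1
  · congr 1; ext j; simp only [Finset.mem_filter, Finset.mem_univ, true_and]; tauto
  · congr 1; ext j; simp only [Finset.mem_filter, Finset.mem_univ, true_and]; tauto

/-- Off-block weight is unchanged by a block move. -/
theorem wtOn_off_bmove (blk : Fin L → Fin k) (u : Fin L → Bool) (i : Fin k) (y : Fin L → Bool) :
    wtOn (univ.filter fun j => blk j ≠ i) (bmove blk u i y) = wtOn (univ.filter fun j => blk j ≠ i) u := by
  unfold wtOn
  congr 1
  refine Finset.filter_congr fun j hj => ?_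
  rw [bmove_off blk u i y (Finset.mem_filter.1 hj).2]

/-- On-block weight after a move is the pattern's block weight. -/
theorem wtOn_on_bmove (blk : Fin L → Fin k) (u : Fin L → Bool) (i : Fin k) (y : Fin L → Bool) :
    wtOn (blockOf blk i) (bmove blk u i y) = wtOn (blockOf blk i) y := by
  unfold wtOn blockOf
  congr 1
  refine Finset.filter_congr fun j hj => ?_
  rw [bmove_on blk u i y (Finset.mem_filter.1 hj).2]

/-- **Weight after a move**: `wt(u ∘ m) + wt_i(u) = wt(u) + wt_i(y)`. -/
theorem wt_bmove (blk : Fin L → Fin k) (u : Fin L → Bool) (i : Fin k) (y : Fin L → Bool) :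
    wt (bmove blk u i y) + wtOn (blockOf blk i) u = wt u + wtOn (blockOf blk i) y := by
  rw [wt_eq_wtOn_add blk i (bmove blk u i y), wt_eq_wtOn_add blk i u, wtOn_off_bmove, wtOn_on_bmove]
  ring

/-- `bmove` twice on the same block keeps the last pattern. -/
theorem bmove_bmove_same (blk : Fin L → Fin k) (u : Fin L → Bool) (i : Fin k) (y y' : Fin L → Bool) :
    bmove blk (bmove blk u i y) i y' = bmove blk u i y' := by
  funext j; unfold bmove; split_ifs <;> rfl

/-- Moving block `i` to `u`'s own pattern does nothing. -/
theorem bmove_self (blk : Fin L → Fin k) (u : Fin L → Bool) (i : Fin k) : bmove blk u i u = u := by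
  funext j; unfold bmove; split_ifs <;> rfl

/-- Moves on distinct blocks commute. -/
theorem bmove_comm (blk : Fin L → Fin k) (u : Fin L → Bool) {i j : Fin k} (hij : i ≠ j)
    (y y' : Fin L → Bool) :
    bmove blk (bmove blk u i y) j y' = bmove blk (bmove blk u j y') i y := by
  funext l; unfold bmove
  by_cases h1 : blk l = j
  · rw [if_pos h1, if_neg (by rw [h1]; exact hij.symm), if_pos h1]
  · rw [if_neg h1, if_neg h1]

/-! ### Norm calculus -/

/-- `distFail D 𝟙 = 0`. -/
theorem distFail_true (D : ℕ) : distFail D (fun _ : Fin L' → Bool => true) = 0 := by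
  have h := distFail_le (fun _ : Fin L' → Bool => true) (isElimFail_true D)
  have h0 : hdist (fun _ : Fin L' → Bool => true) (fun _ : Fin L' → Bool => true) = 0 := by
    unfold hdist; simp
  rw [h0] at h
  exact Nat.le_zero.1 h

/-- **Subadditivity of the code norm**: `‖x ⊕ y‖ ≤ ‖x‖ + ‖y‖`. -/
theorem cnorm_xor_le (D : ℕ) (x y : (Fin L' → Bool) → Bool) :
    cnorm D (fun v => xor (x v) (y v)) ≤ cnorm D x + cnorm D y := by
  unfold cnorm
  have h := distFail_xor3_le D (fun v => !x v) (fun v => !y v) (fun _ => true)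
  rw [distFail_true, add_zero] at h
  have e : (fun v => xor (!x v) (xor (!y v) true)) = fun v => !(xor (x v) (y v)) := by
    funext v; cases x v <;> cases y v <;> rfl
  rw [e] at h
  exact h

/-- **The potential moves by at most the norm of the increment**: `φ(z ⊕ x) ≤ φ(z) + ‖x‖`. -/
theorem distFail_xor_le_add_cnorm (D : ℕ) (z x : (Fin L' → Bool) → Bool) :
    distFail D (fun v => xor (z v) (x v)) ≤ distFail D z + cnorm D x := by
  unfold cnorm
  have h := distFail_xor3_le D z (fun v => !x v) (fun _ => true)
  rw [distFail_true, add_zero] at h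
  have e : (fun v => xor (z v) (xor (!x v) true)) = fun v => xor (z v) (x v) := by
    funext v; cases z v <;> cases x v <;> rfl
  rw [e] at h
  exact h

/-- **The norm of a difference of two rows is at most the sum of their potentials**:
`‖z ⊕ z'‖ ≤ φ(z) + φ(z')`. -/
theorem cnorm_xor_le_distFail_add (D : ℕ) (z z' : (Fin L' → Bool) → Bool) :
    cnorm D (fun v => xor (z v) (z' v)) ≤ distFail D z + distFail D z' := by
  unfold cnorm
  have h := distFail_xor3_le D z z' (fun _ => true)
  rw [distFail_true, add_zero] at h
  have e : (fun v => xor (z v) (xor (z' v) true)) = fun v => !(xor (z v) (z' v)) := by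
    funext v; cases z v <;> cases z' v <;> rfl
  rw [e] at h
  exact h

/-! ### Moves as triples `(block, from-pattern, to-pattern)`; pairs of moves; good pairs -/

/-- A move: a block and two global pattern vectors (only their block-`i` bits matter). -/
abbrev Mv (L k : ℕ) := Fin k × (Fin L → Bool) × (Fin L → Bool)

/-- The move `m` has TYPE `t`: it raises the block weight by `t` modulo `3`. -/
def typ (blk : Fin L → Fin k) (m : Mv L k) (t : ℕ) : Prop :=
  wtOn (blockOf blk m.1) m.2.2 % 3 = (wtOn (blockOf blk m.1) m.2.1 + t) % 3

/-- Increment of a move. -/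
def incrM (G : Fin k → (Fin L → Bool) → (Fin L' → Bool) → Bool) (m : Mv L k) :
    (Fin L' → Bool) → Bool :=
  incr G m.1 m.2.1 m.2.2

/-- Starting configuration of the pair `(a, b)` in context `w`. -/
def start2 (blk : Fin L → Fin k) (a b : Mv L k) (w : Fin L → Bool) : Fin L → Bool :=
  bmove blk (bmove blk w a.1 a.2.1) b.1 b.2.1

/-- Landing configuration of the pair `(a, b)` in context `w`. -/
def end2 (blk : Fin L → Fin k) (a b : Mv L k) (w : Fin L → Bool) : Fin L → Bool :=
  bmove blk (bmove blk w a.1 a.2.2) b.1 b.2.2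

/-- A pair of moves is GOOD (at scale `θ`) if in SOME context both endpoints are `θ`-near. -/
def Good (blk : Fin L → Fin k) (G : Fin k → (Fin L → Bool) → (Fin L' → Bool) → Bool) (D : ℕ)
    (θ : ℝ) (a b : Mv L k) : Prop :=
  ∃ w, start2 blk a b w ∉ far D (gammaBA G) θ ∧ end2 blk a b w ∉ far D (gammaBA G) θ

/-- Block weight on block `j` is unchanged by a move on block `i ≠ j`. -/
theorem wtOn_blockOf_bmove_ne (blk : Fin L → Fin k) (u : Fin L → Bool) {i j : Fin k} (hij : i ≠ j)
    (y : Fin L → Bool) : wtOn (blockOf blk j) (bmove blk u i y) = wtOn (blockOf blk j) u := by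
  unfold wtOn blockOf
  congr 1
  refine Finset.filter_congr fun l hl => ?_
  rw [bmove_off blk u i y (by rw [(Finset.mem_filter.1 hl).2]; exact hij.symm)]

/-- The landing configuration is reached from the start by the two moves. -/
theorem end2_eq (blk : Fin L → Fin k) (a b : Mv L k) (w : Fin L → Bool) :
    end2 blk a b w = bmove blk (bmove blk (start2 blk a b w) a.1 a.2.2) b.1 b.2.2 := by
  funext l
  unfold end2 start2 bmove
  by_cases h1 : blk l = b.1
  · rw [if_pos h1, if_pos h1]
  · rw [if_neg h1, if_neg h1]
    by_cases h2 : blk l = a.1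
    · rw [if_pos h2, if_pos h2]
    · rw [if_neg h2, if_neg h2, if_neg h1, if_neg h2]

/-- **A good pair has a small combined increment**: `‖Δ(a) ⊕ Δ(b)‖ < 2θ·2^{L'}`. -/
theorem cnorm_pair_lt_of_good {blk : Fin L → Fin k} {G : Fin k → (Fin L → Bool) → (Fin L' → Bool) → Bool}
    (hG : BlockLocal blk G) {D : ℕ} {θ : ℝ} {a b : Mv L k} (hab : a.1 ≠ b.1)
    (h : Good blk G D θ a b) :
    (cnorm D (fun v => xor (incrM G a v) (incrM G b v)) : ℝ) < 2 * θ * (2 : ℝ) ^ L' := by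
  obtain ⟨w, hs, he⟩ := h
  set s := start2 blk a b w with hs_def
  have hΓ : gammaBA G (end2 blk a b w) =
      fun v => xor (gammaBA G s v) (xor (incrM G a v) (incrM G b v)) := by
    rw [end2_eq blk a b w, ← hs_def, gammaBA_bmove hG, gammaBA_bmove hG]
    funext v
    beta_reduce
    -- the increments of the moves at `s` are the increments of `a` and `b` (block locality)
    have h1 : incr G a.1 s a.2.2 v = incrM G a v := by
      unfold incrM incr
      rw [hG a.1 s a.2.1 fun j hj => by
        rw [hs_def]; unfold start2
        rw [bmove_off blk _ b.1 b.2.1 (by rw [hj]; exact hab), bmove_on blk w a.1 a.2.1 hj]]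
    have h2 : incr G b.1 (bmove blk s a.1 a.2.2) b.2.2 v = incrM G b v := by
      unfold incrM incr
      rw [hG b.1 (bmove blk s a.1 a.2.2) b.2.1 fun j hj => by
        rw [bmove_off blk s a.1 a.2.2 (by rw [hj]; exact hab.symm), hs_def]
        unfold start2
        rw [bmove_on blk _ b.1 b.2.1 hj]]
    rw [h1, h2, Bool.xor_assoc]
  have hxor : (fun v => xor (incrM G a v) (incrM G b v)) =
      fun v => xor (gammaBA G s v) (gammaBA G (end2 blk a b w) v) := by
    funext v
    rw [hΓ]
    beta_reduce
    cases gammaBA G s v <;> cases incrM G a v <;> cases incrM G b v <;> rfl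
  rw [hxor]
  have h1 : (distFail D (gammaBA G s) : ℝ) < θ * (2 : ℝ) ^ L' := by
    have := hs; unfold far at this; simpa using this
  have h2 : (distFail D (gammaBA G (end2 blk a b w)) : ℝ) < θ * (2 : ℝ) ^ L' := by
    have := he; unfold far at this; simpa using this
  have h3 := cnorm_xor_le_distFail_add D (gammaBA G s) (gammaBA G (end2 blk a b w))
  have h3' : (cnorm D (fun v => xor (gammaBA G s v) (gammaBA G (end2 blk a b w) v)) : ℝ) ≤
      (distFail D (gammaBA G s) : ℝ) + (distFail D (gammaBA G (end2 blk a b w)) : ℝ) := by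
    exact_mod_cast h3
  linarith

end BlockAdditive

end Summit.QuantumAdvantage.AdviceFreeQNC0

end
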